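import Summits.ResolutionOfSingularities.ResolutionOfSingularities.Theorems.WeightedInvariantIotaOrder
import Literature.AlgebraicGeometry.Resolution.SmoothUniformizationProofs
import Literature.AlgebraicGeometry.Resolution.OrderFlatLocalHom
import HarnessLib

/-!
# The order function is invariant under essentially smooth local homomorphisms (door H2a‴, clause (c11), ι-half)

Topic: `Summits/ResolutionOfSingularities/ResolutionOfSingularities/Theorems`. Helper for the door item
`HypersurfaceCentreConstruction` (statement `stmt-ResolutionOfSingularities-19897`, route `WeightedInvariant`):
the ι-half of conjunct (c11) `LocalEngine.IotaJEssSmoothCompatible` of the tree's clause module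
`WeightedInvariantHypersurfaceLocalGameEFT3` (res-L1-w43-plan-1 eft v7/v8; stub-9 = res-D-brk-1 CRITIC (E6) TYPING
POINT 1) at the first ι-instance `LocalEngine.iotaOrd` of ORDER (o11) (res-type-073, `WeightedInvariantIotaOrder`):
**for a LOCAL, FORMALLY SMOOTH, essentially-of-finite-type homomorphism `S → S'` of regular local rings and
`f ∈ S`, `iotaOrd S' f = iotaOrd S f`** (`iotaOrd_essSmooth_eq`), i.e. `f ∈ 𝔪_Sⁿ ↔ f ∈ 𝔪_{S'}ⁿ` for all `n`
(`mem_maximalIdeal_pow_iff_of_formallySmooth`; `ℕ∞` form `adicOrder_algebraMap_eq_of_formallySmooth`).  Consequently `IotaJEssSmoothCompatible iotaOrd J` reduces to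
its `J`-half (`iotaJEssSmoothCompatible_iotaOrd_iff`).  res-type-039, STATUS 2026-08-27T05:49Z (reserve volunteer
on the (o·) desk's terms).

[OURS · L1 W4.3] Replaces the role of NO printed item; NOT a statement of the manuscript
[claim: Hironaka2017, status: under-review]. AI work, weaker than expert review.

## Proof (all inputs are tree / Mathlib theorems; template `Resolution.Grothendieck1967_17_5_8_holds`)

* `S'` is essentially of finite type over `S`, so it is the localisation of a finite-type subalgebra `A₀` at the
  prime `𝔪_{S'} ∩ A₀`; presenting `A₀` as a quotient of `S[X₁,…,Xₙ]` exhibits `S'` as a quotient of the local ring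
  `P = S[X]_𝔓` of an affine space over `S`, which is flat and Noetherian; Mathlib's
  `Algebra.FormallySmooth.flat_of_algHom_of_isNoetherianRing` then gives **`S'` flat over `S`**
  (`flat_of_formallySmooth_of_essFiniteType`).
* The closed fibre `k_S ⊗_S S' ≅ S'/𝔪_S S'` is local, formally smooth and essentially of finite type over the
  residue field, hence **regular** (tree `Resolution.isRegularLocalRing_of_formallySmooth_of_essFiniteType`,
  Görtz–Wedhorn 6.26).
* For a flat local homomorphism of Noetherian local rings with regular closed fibre, `a ∈ 𝔪_Sⁿ ↔ a ∈ 𝔪_{S'}ⁿ`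
  (tree `Resolution.mem_pow_maximalIdeal_iff_of_isRegularLocalRing_fiber`, Matsumura §22).
* `iotaOrd` on a local ring is determined by these memberships (`iotaOrd_le_iotaOrd_of_forall`).

Regularity of `S` and `S'` (binders of the clause) is not used beyond Noetherianity of `S`; the statements below
keep the clause's binders verbatim where they instantiate it and drop them where they are idle.

## References

* H. Matsumura, *Commutative Ring Theory*, §22 (flat local homomorphisms, fibres) and Thm. 23.7.
  [cite: Matsumura1987, §22 Cor. to Thm. 22.5]
* U. Görtz, T. Wedhorn, *Algebraic Geometry I*, Lemma 6.26. [GortzWedhorn2020]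
* A. Grothendieck, EGA IV₄ 17.5.8 (iii). [Grothendieck1967]
-/

noncomputable section

open IsLocalRing Literature.AlgebraicGeometry.Resolution
open scoped TensorProduct

set_option linter.dupNamespace false -- mandated namespace of this single-conjunct summit

namespace Summit.ResolutionOfSingularities.ResolutionOfSingularities.Cruxes.HypersurfaceCentreConstruction.LocalEngine

namespace IotaOrderEssSmooth

universe u

/-- **Formally smooth + essentially of finite type over a Noetherian ring, with local target ⇒ flat.**
`S'` local and essentially of finite type over `S` is the localisation of a finite-type subalgebra at a prime,
hence a quotient of a (flat, Noetherian) local ring of an affine space over `S`; formal smoothness splits the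
adic projection (Mathlib `Algebra.FormallySmooth.flat_of_algHom_of_isNoetherianRing`). [folklore]
[cite: Matsumura1987, §22 Cor. to Thm. 22.5] -/
theorem flat_of_formallySmooth_of_essFiniteType (S S' : Type u) [CommRing S] [CommRing S']
    [IsNoetherianRing S] [IsLocalRing S'] [Algebra S S'] [Algebra.FormallySmooth S S']
    [Algebra.EssFiniteType S S'] : Module.Flat S S' := by
  classical
  let A₀ : Subalgebra S S' := Algebra.EssFiniteType.subalgebra S S'
  haveI hA₀ : Algebra.FiniteType S A₀ := inferInstance
  let q₀ : Ideal A₀ := (maximalIdeal S').comap (algebraMap A₀ S')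
  haveI hq₀ : q₀.IsPrime := Ideal.comap_isPrime _ _
  -- `S'` is the localisation of `A₀` at `q₀`
  haveI : IsLocalization.AtPrime S' q₀ := by
    refine IsLocalization.of_le (Algebra.EssFiniteType.submonoid S S') q₀.primeCompl ?_ ?_
    · intro a ha haq
      have hu : IsUnit (algebraMap A₀ S' a) := ha
      exact (IsLocalRing.mem_maximalIdeal _).mp (Ideal.mem_comap.mp haq) hu
    · intro a ha
      by_contra hu
      exact ha (Ideal.mem_comap.mpr ((IsLocalRing.mem_maximalIdeal _).mpr hu))
  -- present `A₀` as a quotient of a polynomial ring and `S'` as a quotient of a local ring of it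
  obtain ⟨n, f₀, hf₀⟩ := Algebra.FiniteType.iff_quotient_mvPolynomial''.mp hA₀
  let 𝔓 : Ideal (MvPolynomial (Fin n) S) := q₀.comap f₀
  haveI : 𝔓.IsPrime := Ideal.comap_isPrime f₀ q₀
  let P := Localization.AtPrime 𝔓
  let fP : P →ₐ[S] S' := IsLocalization.liftAlgHom (M := 𝔓.primeCompl)
      (f := (IsScalarTower.toAlgHom S A₀ S').comp f₀) fun x => by
    have hx : f₀ x.1 ∈ q₀.primeCompl := x.2
    simpa using IsLocalization.map_units (M := q₀.primeCompl) S' ⟨f₀ x.1, hx⟩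
  have hf₁ : Function.Surjective fP := by
    intro x
    obtain ⟨x, ⟨s, hs⟩, rfl⟩ := IsLocalization.exists_mk'_eq q₀.primeCompl x
    obtain ⟨x, rfl⟩ := hf₀ x
    obtain ⟨s, rfl⟩ := hf₀ s
    refine ⟨IsLocalization.mk' (M := 𝔓.primeCompl) P x ⟨s, hs⟩, ?_⟩
    simp [fP, IsLocalization.lift_mk', Units.mul_inv_eq_iff_eq_mul, IsUnit.liftRight]
    exact (IsLocalization.mk'_spec S' (f₀ x) ⟨f₀ s, hs⟩).symm
  exact Algebra.FormallySmooth.flat_of_algHom_of_isNoetherianRing fP hf₁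

/-- **The closed fibre of a local, formally smooth, essentially-of-finite-type homomorphism is regular**:
`S' ⧸ 𝔪_S S'` is a regular local ring (it is `k_S ⊗_S S'`, local, formally smooth and essentially of finite type
over the residue field `k_S`; tree `Resolution.isRegularLocalRing_of_formallySmooth_of_essFiniteType`).
[cite: GortzWedhorn2020, Lemma 6.26 (p. 196)] -/
theorem isRegularLocalRing_fibre_of_formallySmooth (S S' : Type u) [CommRing S] [CommRing S']
    [IsLocalRing S] [IsLocalRing S'] [Algebra S S'] [IsLocalHom (algebraMap S S')]
    [Algebra.FormallySmooth S S'] [Algebra.EssFiniteType S S'] :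
    IsRegularLocalRing (S' ⧸ (maximalIdeal S).map (algebraMap S S')) := by
  haveI : IsRegularLocalRing (ResidueField S ⊗[S] S') :=
    isRegularLocalRing_of_formallySmooth_of_essFiniteType (ResidueField S) _
  let e : ResidueField S ⊗[S] S' ≃+* S' ⧸ (maximalIdeal S).map (algebraMap S S') :=
    (Algebra.TensorProduct.comm S (ResidueField S) S').toRingEquiv.trans
      (Algebra.TensorProduct.quotIdealMapEquivTensorQuot S' (maximalIdeal S)).toRingEquiv.symm
  exact IsRegularLocalRing.of_ringEquiv e

/-- **`f ∈ 𝔪_Sⁿ ↔ f ∈ 𝔪_{S'}ⁿ`** along a local, formally smooth, essentially-of-finite-type homomorphism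
`S → S'` of Noetherian local rings (flat with regular closed fibre, then Matsumura §22 via the tree's
`Resolution.mem_pow_maximalIdeal_iff_of_isRegularLocalRing_fiber`). [cite: Matsumura1987, §22 Cor. to Thm. 22.5] -/
theorem mem_maximalIdeal_pow_iff_of_formallySmooth (S S' : Type u) [CommRing S] [CommRing S']
    [IsLocalRing S] [IsNoetherianRing S] [IsLocalRing S'] [IsNoetherianRing S'] [Algebra S S']
    [IsLocalHom (algebraMap S S')] [Algebra.FormallySmooth S S'] [Algebra.EssFiniteType S S']
    (n : ℕ) (f : S) :
    f ∈ maximalIdeal S ^ n ↔ algebraMap S S' f ∈ maximalIdeal S' ^ n := by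
  haveI : Module.Flat S S' := flat_of_formallySmooth_of_essFiniteType S S'
  exact mem_pow_maximalIdeal_iff_of_isRegularLocalRing_fiber
    (isRegularLocalRing_fibre_of_formallySmooth S S') n f

/-- **`ord_{S'}(f) = ord_S(f)`** (tree `Resolution.adicOrder`, `ℕ∞`-valued) along a local, formally smooth,
essentially-of-finite-type homomorphism of Noetherian local rings — the form every order-type class function
(`φ ∘ adicOrder` on local rings) consumes. [cite: Matsumura1987, §22 Cor. to Thm. 22.5] -/
theorem adicOrder_algebraMap_eq_of_formallySmooth (S S' : Type u) [CommRing S] [CommRing S']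
    [IsLocalRing S] [IsNoetherianRing S] [IsLocalRing S'] [IsNoetherianRing S'] [Algebra S S']
    [IsLocalHom (algebraMap S S')] [Algebra.FormallySmooth S S'] [Algebra.EssFiniteType S S'] (f : S) :
    adicOrder (algebraMap S S' f) = adicOrder f := by
  refine le_antisymm ?_ ?_
  · refine ENat.forall_natCast_le_iff_le.mp fun n hn => ?_
    rw [le_adicOrder_iff] at hn ⊢
    exact (mem_maximalIdeal_pow_iff_of_formallySmooth S S' n f).mpr hn
  · refine ENat.forall_natCast_le_iff_le.mp fun n hn => ?_
    rw [le_adicOrder_iff] at hn ⊢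
    exact (mem_maximalIdeal_pow_iff_of_formallySmooth S S' n f).mp hn

end IotaOrderEssSmooth

open IotaOrderEssSmooth

/-- **(c11), ι-half, for the order function**: along a local, formally smooth, essentially-of-finite-type
homomorphism `S → S'` of regular local rings (the binders of `IotaJEssSmoothCompatible` verbatim),
`iotaOrd S' f = iotaOrd S f`. [OURS · L1 W4.3 · door H2a‴ (c11)] [cite: Matsumura1987, §22 Cor. to Thm. 22.5] -/
theorem iotaOrd_essSmooth_eq (S S' : Type) [CommRing S] [CommRing S'] [IsRegularLocalRing S]
    [IsRegularLocalRing S'] [Algebra S S'] [IsLocalHom (algebraMap S S')] [Algebra.FormallySmooth S S']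
    [Algebra.EssFiniteType S S'] (f : S) :
    iotaOrd S' (algebraMap S S' f) = iotaOrd S f := by
  refine le_antisymm ?_ ?_
  · exact iotaOrd_le_iotaOrd_of_forall S S' f (algebraMap S S' f) fun n hn =>
      (mem_maximalIdeal_pow_iff_of_formallySmooth S S' n f).mpr hn
  · exact iotaOrd_le_iotaOrd_of_forall S' S (algebraMap S S' f) f fun n hn =>
      (mem_maximalIdeal_pow_iff_of_formallySmooth S S' n f).mp hn

/-- **Reduction of (c11) at `ι = iotaOrd` to its `J`-half**: for every centre filtration `J`,
`IotaJEssSmoothCompatible iotaOrd J` holds iff `J` extends along local, formally smooth, essentially-of-finite-type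
homomorphisms of regular local rings. [OURS · L1 W4.3 · door H2a‴ (c11)] [folklore] -/
theorem iotaJEssSmoothCompatible_iotaOrd_iff (J : (R : Type) → [CommRing R] → R → ℕ → Ideal R) :
    IotaJEssSmoothCompatible iotaOrd J ↔
      ∀ (S S' : Type) [CommRing S] [CommRing S'] [IsRegularLocalRing S] [IsRegularLocalRing S'] [Algebra S S']
        [IsLocalHom (algebraMap S S')] [Algebra.FormallySmooth S S'] [Algebra.EssFiniteType S S'] (f : S),
        ∀ m : ℕ, J S' (algebraMap S S' f) m = (J S f m).map (algebraMap S S') := by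
  constructor
  · intro h S S' _ _ _ _ _ _ _ _ f
    exact (h S S' f).2
  · intro h S S' _ _ _ _ _ _ _ _ f
    exact ⟨iotaOrd_essSmooth_eq S S' f, h S S' f⟩

end Summit.ResolutionOfSingularities.ResolutionOfSingularities.Cruxes.HypersurfaceCentreConstruction.LocalEngine

end
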